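import Summits.QuantumFields.YangMills.Theorems.ParabolicTrajectoryTunedSequenceExistsUnitsCore

/-! Scratch (lead c7): the planner-facing INLINED bodies of X_Q / X_P (Theses-vocabulary only: `plaquetteObs r.ρ 0 1 2`
in place of `RPDiagonalVariant.spatialPlaquette r`), certified `Iff.rfl` against the landed `UnitsCore` definitions. -/

open Filter Topology
open Literature.MathematicalPhysics.QuantumFieldTheory Literature.MathematicalPhysics.QuantumLattice

/-- X_Q, inlined (child body for option γ). -/
def XQBody : Prop :=
  ∀ (G : Type) [Group G] [TopologicalSpace G] [IsTopologicalGroup G] [CompactSpace G],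
    Literature.MathematicalPhysics.QuantumFieldTheory.IsCompactSimpleLieGroup G → letI : MeasurableSpace G := borel G; haveI : BorelSpace G := ⟨rfl⟩;
    ∀ (r : Literature.MathematicalPhysics.QuantumFieldTheory.LatticeRep G),
      ∃ a : ℝ → ℝ, Continuous a ∧ (∀ β, 0 < a β) ∧ Filter.Tendsto a Filter.atTop (nhds 0) ∧
        ∃ (s₁ s₂ ε β₅ Λ₅ : ℝ), 0 < s₁ ∧ s₁ ≤ s₂ ∧ 0 < ε ∧
          ∀ β : ℝ, β₅ ≤ β → ∀ (L D : ℕ), Λ₅ ≤ a β * L → s₁ ≤ D * a β → D * a β ≤ s₂ →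
            ε ≤ (D : ℝ) ^ 8 * Literature.MathematicalPhysics.QuantumFieldTheory.latticeConnectedCorr r.ρ β (2 * L + 1)
              (Literature.MathematicalPhysics.QuantumLattice.plaquetteObs r.ρ 0 1 2)
              (Literature.MathematicalPhysics.QuantumLattice.plaquetteObs r.ρ 0 1 2) D

/-- X_P, inlined (child body for option γ on P). -/
def XPBody : Prop :=
  ∀ (G : Type) [Group G] [TopologicalSpace G] [IsTopologicalGroup G] [CompactSpace G],
    Literature.MathematicalPhysics.QuantumFieldTheory.IsCompactSimpleLieGroup G → letI : MeasurableSpace G := borel G; haveI : BorelSpace G := ⟨rfl⟩;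
    ∀ (r : Literature.MathematicalPhysics.QuantumFieldTheory.LatticeRep G),
      ∃ a : ℝ → ℝ, Continuous a ∧ (∀ β, 0 < a β) ∧ Filter.Tendsto a Filter.atTop (nhds 0) ∧
        ∃ (s₁ s₂ ε β₅ Λ₅ : ℝ), 0 < s₁ ∧ s₁ ≤ s₂ ∧ 0 < ε ∧
          ∀ β : ℝ, β₅ ≤ β → ∀ (L D : ℕ), Λ₅ ≤ a β * L → s₁ ≤ D * a β → D * a β ≤ s₂ →
            ε ≤ (D : ℝ) ^ 8 * Literature.MathematicalPhysics.QuantumFieldTheory.latticeConnectedCorr r.ρ β (2 * L + 1)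
              r.curvature.F r.curvature.F D

example : XQBody ↔ Summit.QuantumFields.YangMills.Theorems.TunedSequenceExists.UnitsCore.SharpLowerBoundQAll := Iff.rfl
example : XPBody ↔ Summit.QuantumFields.YangMills.Theorems.TunedSequenceExists.UnitsCore.SharpLowerBoundAll := Iff.rfl

/-- Option γ_Q closes (S_Q) from the inlined body (by the landed glue). -/
example (h : XQBody) : Summit.QuantumFields.YangMills.Theorems.TunedSequenceExists.RPDiagonalVariant.TunedSequenceExistsQ :=
  Summit.QuantumFields.YangMills.Theorems.TunedSequenceExists.UnitsCore.tunedSequenceExistsQ_of_sharpQ h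

/-- Option γ_P closes (S) as filed from the inlined body + the two mirror children (by the landed glue). -/
example (h : XPBody) (hIn : Summit.QuantumFields.YangMills.Theorems.TunedSequenceExists.FixedAspectSplit.MirrorBoundInAll)
    (hOut : Summit.QuantumFields.YangMills.Theorems.TunedSequenceExists.FixedAspectSplit.MirrorBoundOutAll) :
    Summit.QuantumFields.YangMills.Theses.ParabolicTrajectory.TunedSequenceExists :=
  Summit.QuantumFields.YangMills.Theorems.TunedSequenceExists.UnitsCore.tunedSequenceExists_of_sharp_mirror_subs h hIn hOut
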